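/-
Copyright: the b2b-balaban T⁴-continuum CRUX team, row NE7b OWNER lineage `t4-ne7b-p1` (gen 137). Project licence.
-/
import Summits.QuantumFields.BalabanUV.T4Continuum.Spine.NE7b.SupBlockEffectiveActionThirdDerivative

/-!
# THE THIRD DERIVATIVE OF THE NEXT POTENTIAL IS CONTINUOUS; THE OUTPUT IS FRÉCHET-`C³` — the class-closure plan, item (c), completed.
# For a `C³` block input `U` with the four block letters over `N(0,M⁻¹)` (regulator margin, `0 < θ`): the trilinear third derivative
# `T(ψ)` of `W = −log Z` ((419)) is CONTINUOUS in `ψ` (continuity of `Z`, `G`, `H` from their differentiability (402)∕(418), of `∫Φ` by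
# dominated continuity under (418)'s third domination, and of the bilinear assembly); hence the output single-block potential `w⁺` of (415)
# has `(w⁺)″` differentiable everywhere with derivative `(w⁺)‴(ζ) = T(ψ₀+ζ)`, a continuous map of `ζ` — the input format's `hU''d` and `hU₃c`
# REGENERATED for the output; only the LETTER `κ₃⁺` (a uniform bound on `‖T‖`) remains of the class (row NE7b, node U5c; (402)∕(415)∕(418)∕(419)
# BY NAME; [folklore])

Cell `pub-balaban`, sub-cell `t4`, spine estimate NE7b (`T4WeightBudget.RelWeightBound`; the cell's OWN estimate — NOT PRINTED in
[Bałaban 1983–89], NOT PROVED).  Crux-route work under `Spine/NE7b/` by the row OWNER (`t4-ne7b-p1` gen 137, file (420)) under FREEZE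
(0)'s crux-prover clause (this gen's class-closure audit, item (c)); NOTHING of Bałaban's is named as a Lean object, valued or asserted; no
`T4Continuum/Support` leaf typed; no `def`, no notation (`T`, `(w⁺)″` WRITTEN OUT); zero `sorry`.  Imports (BY NAME): the OWNER's (419)
`…SupBlockEffectiveActionThirdDerivative` (`hasFDerivAt_hessW`) and through it (418) (`hasFDerivAt_block_tiltedHessNumerator`,
`continuous_weightedBlockHess_deriv`, `block_third_domination_op`), (402) (`hasFDerivAt_block_step`, `hasFDerivAt_block_tiltedNumerator`), (399)
(`integrable_exp_neg_block`), (313) (`integrable_domination`); Mathlib's `MeasureTheory.continuousAt_of_dominated`.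

WHAT IS PROVED ([folklore]):
* §1 `continuous_blockZ`, `continuous_blockG`, `continuous_blockH`, `continuous_blockT3` (dominated continuity of `ψ ↦ ∫Φ(ω,ψ)`);
* §2 `continuous_hessW_deriv_term1`, `continuous_hessW_deriv_uprime`, `continuous_hessW_deriv_t2a∕t2b0∕t2b`, `continuous_hessW_deriv_term2`, **`continuous_hessW_deriv`**
    (`ψ ↦ T(ψ)` continuous);
* §3 THE END for the output: **`hasFDerivAt_blockOutput_hess`** (`HasFDerivAt (w⁺)″ (T(ψ₀+ζ)) ζ`), **`continuous_blockOutput_third`**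
  (`ζ ↦ T(ψ₀+ζ)` continuous); §4 toy.

HONEST (what this is NOT).  Regularity only; the uniform letter `κ₃⁺` (log-concave concentration: the tilted Poincaré inequality and the fourth
centred moment) is the remaining analytic file of the plan, then the assembly; no contraction ((β4)), no decaying-covariance polymer expansion
((β3′)); scalar skeleton ((A3), NC-NE7b-α UNRULED); nothing of Bałaban's asserted.  BY-NAME EFFECT ON THE WALL: NONE.  NE7b NOT PRINTED ∕ NOT
PROVED; spine PROVED 0∕9; rung (B)+1 — the programme's measures remain FINITE-torus statements; NOT the mass gap, NOT Clay.  HONEST DEPENDENCY: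
continuum YM on T⁴ ⇐ BetaPertH ∧ nine spine estimates (0∕9 proved); BetaPertH ⇐ (D1) ∧ (D4) ∧ CAP+tail; G-an2-4 gates asym, D1 and NE2∕3∕4.
-/

set_option autoImplicit false
set_option maxSynthPendingDepth 3

noncomputable section

namespace Summit.QuantumFields.BalabanUV.T4Continuum.NE7b.SupBlockThirdDerivativeContinuous

open MeasureTheory ProbabilityTheory Finset Real Metric Filter
open scoped BigOperators Topology
open SupEffectiveActionDerivative (integrable_domination mul_opBound_le_of_le)
open SupBlockEffectiveActionDerivative (integrable_exp_neg_block)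
open SupBlockEffectiveActionHessian (hasFDerivAt_block_step hasFDerivAt_block_tiltedNumerator)
open SupBlockEffectiveActionThird (hasFDerivAt_block_tiltedHessNumerator continuous_weightedBlockHess_deriv block_third_domination_op)
open SupBlockEffectiveActionThirdDerivative (hasFDerivAt_hessW)

variable {ι : Type} [Fintype ι] [DecidableEq ι]

section Main

variable {M : Matrix ι ι ℝ} {γop : ℝ} {U : EuclideanSpace ℝ ι → ℝ} {U' : EuclideanSpace ℝ ι → EuclideanSpace ℝ ι →L[ℝ] ℝ}
  {U'' : EuclideanSpace ℝ ι → EuclideanSpace ℝ ι →L[ℝ] EuclideanSpace ℝ ι →L[ℝ] ℝ}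
  {U₃ : EuclideanSpace ℝ ι → EuclideanSpace ℝ ι →L[ℝ] EuclideanSpace ℝ ι →L[ℝ] EuclideanSpace ℝ ι →L[ℝ] ℝ} {κ₀ κ₁ κ₂ κ₃ a τ δ θ : ℝ}

/-! ## §1. The four background integrals are continuous -/

/-- `ψ ↦ Z(ψ)` is continuous and positive (differentiable by (402)). [folklore] -/
theorem continuous_blockZ (hM : M.PosDef) (hΓop : (γop • (1 : Matrix ι ι ℝ) - M⁻¹).PosSemidef) (Y : Finset ι)
    (hUd : ∀ φ : EuclideanSpace ℝ ι, HasFDerivAt U (U' φ) φ) (hU'd : ∀ φ : EuclideanSpace ℝ ι, HasFDerivAt U' (U'' φ) φ)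
    (hκ₀ : 0 ≤ κ₀) (hκ₁ : 0 ≤ κ₁) (ha : 0 ≤ a) (hτ : 0 < τ) (hδ : 0 < δ)
    (hθ0 : 0 < θ) (hθ1 : θ < 1) (hκθ : (2 * κ₀ * (1 + τ) + 4 * δ) * γop ≤ θ) (hstab : ∀ φ : EuclideanSpace ℝ ι, -(κ₀ * ∑ x ∈ Y, φ x ^ 2) ≤ U φ)
    (hU'b : ∀ φ : EuclideanSpace ℝ ι, ‖U' φ‖ ≤ κ₁ * (a + ∑ x ∈ Y, φ x ^ 2)) :
    (Continuous fun ψ : EuclideanSpace ℝ ι => (∫ ω : EuclideanSpace ℝ ι, exp (-U (ω + ψ)) ∂(multivariateGaussian 0 M⁻¹))) ∧ ∀ ψ : EuclideanSpace ℝ ι, 0 < (∫ ω :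
        EuclideanSpace ℝ ι, exp (-U (ω + ψ)) ∂(multivariateGaussian 0 M⁻¹)) := by
  have hΓ : (M⁻¹).PosSemidef := hM.inv.posSemidef
  have hU'c : Continuous U' := continuous_iff_continuousAt.2 fun φ => (hU'd φ).continuousAt
  have hUc : Continuous U := continuous_iff_continuousAt.2 fun φ => (hUd φ).continuousAt
  have hκθ₀ : 2 * κ₀ * (1 + τ) * γop ≤ θ := mul_opBound_le_of_le (by positivity) (by linarith) hθ0.le hκθ
  refine ⟨continuous_iff_continuousAt.2 fun ψ => (hasFDerivAt_block_step hΓ hΓop Y hUd hU'c hκ₀ hκ₁ ha hτ hδ hθ0 hθ1 hκθ hstab hU'b ψ).continuousAt, fun ψ => ?_⟩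
  exact integral_exp_pos (integrable_exp_neg_block hΓ hΓop Y hUc.measurable hκ₀ hτ hθ1 hκθ₀ hstab ψ)

/-- `ψ ↦ G(ψ) = ∫e^{−U}•U′` is continuous (differentiable by (402)). [folklore] -/
theorem continuous_blockG (hM : M.PosDef) (hΓop : (γop • (1 : Matrix ι ι ℝ) - M⁻¹).PosSemidef) (Y : Finset ι)
    (hUd : ∀ φ : EuclideanSpace ℝ ι, HasFDerivAt U (U' φ) φ) (hU'd : ∀ φ : EuclideanSpace ℝ ι, HasFDerivAt U' (U'' φ) φ)
    (hU''d : ∀ φ : EuclideanSpace ℝ ι, HasFDerivAt U'' (U₃ φ) φ) (hκ₀ : 0 ≤ κ₀) (hκ₁ : 0 ≤ κ₁) (ha : 0 ≤ a) (hκ₂ : 0 ≤ κ₂) (hτ : 0 < τ) (hδ : 0 < δ)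
    (hθ1 : θ < 1) (hκθ : (2 * κ₀ * (1 + τ) + 4 * δ) * γop ≤ θ) (hstab : ∀ φ : EuclideanSpace ℝ ι, -(κ₀ * ∑ x ∈ Y, φ x ^ 2) ≤ U φ)
    (hU'b : ∀ φ : EuclideanSpace ℝ ι, ‖U' φ‖ ≤ κ₁ * (a + ∑ x ∈ Y, φ x ^ 2)) (hU''b : ∀ φ : EuclideanSpace ℝ ι, ‖U'' φ‖ ≤ κ₂) :
    Continuous fun ψ : EuclideanSpace ℝ ι => (∫ ω : EuclideanSpace ℝ ι, exp (-U (ω + ψ)) • U' (ω + ψ) ∂(multivariateGaussian 0 M⁻¹)) := by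
  have hΓ : (M⁻¹).PosSemidef := hM.inv.posSemidef
  have hU''c : Continuous U'' := continuous_iff_continuousAt.2 fun φ => (hU''d φ).continuousAt
  exact continuous_iff_continuousAt.2 fun ψ => (hasFDerivAt_block_tiltedNumerator hΓ hΓop Y hUd hU'd hU''c hκ₀ hκ₁ ha hκ₂ hτ hδ hθ1 hκθ hstab hU'b hU''b ψ).continuousAt

/-- `ψ ↦ H(ψ) = ∫e^{−U}•(U″ − U′⊗U′)` is continuous (differentiable by (418)). [folklore] -/
theorem continuous_blockH (hM : M.PosDef) (hΓop : (γop • (1 : Matrix ι ι ℝ) - M⁻¹).PosSemidef) (Y : Finset ι)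
    (hUd : ∀ φ : EuclideanSpace ℝ ι, HasFDerivAt U (U' φ) φ) (hU'd : ∀ φ : EuclideanSpace ℝ ι, HasFDerivAt U' (U'' φ) φ)
    (hU''d : ∀ φ : EuclideanSpace ℝ ι, HasFDerivAt U'' (U₃ φ) φ) (hU₃c : Continuous U₃) (hκ₀ : 0 ≤ κ₀) (hκ₁ : 0 ≤ κ₁) (ha : 0 ≤ a) (hκ₂ : 0 ≤ κ₂) (hκ₃ : 0 ≤ κ₃) (hτ : 0 <
        τ) (hδ : 0 < δ)
    (hθ1 : θ < 1) (hκθ : (2 * κ₀ * (1 + τ) + 4 * δ) * γop ≤ θ) (hstab : ∀ φ : EuclideanSpace ℝ ι, -(κ₀ * ∑ x ∈ Y, φ x ^ 2) ≤ U φ)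
    (hU'b : ∀ φ : EuclideanSpace ℝ ι, ‖U' φ‖ ≤ κ₁ * (a + ∑ x ∈ Y, φ x ^ 2)) (hU''b : ∀ φ : EuclideanSpace ℝ ι, ‖U'' φ‖ ≤ κ₂)
    (hU₃b : ∀ φ : EuclideanSpace ℝ ι, ‖U₃ φ‖ ≤ κ₃) :
    Continuous fun ψ : EuclideanSpace ℝ ι => (∫ ω : EuclideanSpace ℝ ι, exp (-U (ω + ψ)) • (U'' (ω + ψ) - (U' (ω + ψ)).smulRight (U' (ω + ψ))) ∂(multivariateGaussian 0
        M⁻¹)) := by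
  have hΓ : (M⁻¹).PosSemidef := hM.inv.posSemidef
  exact continuous_iff_continuousAt.2 fun ψ => (hasFDerivAt_block_tiltedHessNumerator hΓ hΓop Y hUd hU'd hU''d hU₃c hκ₀ hκ₁ ha hκ₂ hκ₃ hτ hδ hθ1 hκθ hstab hU'b hU''b hU₃b
      ψ).continuousAt

/-- **`ψ ↦ ∫Φ(ω,ψ)dN(0,M⁻¹)` is continuous** (dominated continuity on unit balls under (418)'s third domination; `Φ` depends on `ω + ψ` only,
so its continuity in `ψ` is (418)'s continuity in `ω`). [folklore] -/
theorem continuous_blockT3 (hM : M.PosDef) (hΓop : (γop • (1 : Matrix ι ι ℝ) - M⁻¹).PosSemidef) (Y : Finset ι)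
    (hUd : ∀ φ : EuclideanSpace ℝ ι, HasFDerivAt U (U' φ) φ) (hU'd : ∀ φ : EuclideanSpace ℝ ι, HasFDerivAt U' (U'' φ) φ)
    (hU''d : ∀ φ : EuclideanSpace ℝ ι, HasFDerivAt U'' (U₃ φ) φ) (hU₃c : Continuous U₃) (hκ₀ : 0 ≤ κ₀) (hκ₁ : 0 ≤ κ₁) (ha : 0 ≤ a) (hκ₂ : 0 ≤ κ₂) (hκ₃ : 0 ≤ κ₃) (hτ : 0 <
        τ) (hδ : 0 < δ)
    (hθ1 : θ < 1) (hκθ : (2 * κ₀ * (1 + τ) + 4 * δ) * γop ≤ θ) (hstab : ∀ φ : EuclideanSpace ℝ ι, -(κ₀ * ∑ x ∈ Y, φ x ^ 2) ≤ U φ)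
    (hU'b : ∀ φ : EuclideanSpace ℝ ι, ‖U' φ‖ ≤ κ₁ * (a + ∑ x ∈ Y, φ x ^ 2)) (hU''b : ∀ φ : EuclideanSpace ℝ ι, ‖U'' φ‖ ≤ κ₂)
    (hU₃b : ∀ φ : EuclideanSpace ℝ ι, ‖U₃ φ‖ ≤ κ₃) :
    Continuous fun ψ : EuclideanSpace ℝ ι => (∫ ω : EuclideanSpace ℝ ι, (exp (-U (ω + ψ)) • (U₃ (ω + ψ) - (((ContinuousLinearMap.smulRightL ℝ (EuclideanSpace ℝ ι)
        (EuclideanSpace ℝ ι →L[ℝ] ℝ)) (U' (ω + ψ))).comp (U'' (ω + ψ)) + (((ContinuousLinearMap.smulRightL ℝ (EuclideanSpace ℝ ι) (EuclideanSpace ℝ ι →L[ℝ] ℝ))).comp (U''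
        (ω + ψ))).flip (U' (ω + ψ)))) + (exp (-U (ω + ψ)) • -U' (ω + ψ)).smulRight (U'' (ω + ψ) - (U' (ω + ψ)).smulRight (U' (ω + ψ)))) ∂(multivariateGaussian 0 M⁻¹)) := by
  have hΓ : (M⁻¹).PosSemidef := hM.inv.posSemidef
  refine continuous_iff_continuousAt.2 fun ψ₀ => ?_
  have hball : ∀ᶠ ψ in 𝓝 ψ₀, ψ ∈ closedBall ψ₀ 1 := closedBall_mem_nhds ψ₀ one_pos
  refine continuousAt_of_dominated (Eventually.of_forall fun ψ => (continuous_weightedBlockHess_deriv hUd hU'd hU''d hU₃c ψ).aestronglyMeasurable) ?_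
    (integrable_domination hΓ hΓop Y hκ₀ hτ hδ hθ1 hκθ (exp (κ₀ * (1 + τ⁻¹) * (2 * ∑ x ∈ Y, ψ₀ x ^ 2 + 2)) * (κ₁ ^ 3 * (4 * (a + 2 * (2 * ∑ x ∈ Y, ψ₀ x ^ 2 + 2)) ^ 3 + 32 *
        (δ ^ 3)⁻¹) + 3 * κ₂ * κ₁ * ((a + 2 * (2 * ∑ x ∈ Y, ψ₀ x ^ 2 + 2)) + δ⁻¹) + κ₃))) (ae_of_all _ fun ω => ?_)
  · filter_upwards [hball] with ψ hψ
    rw [mem_closedBall, dist_eq_norm] at hψ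
    exact ae_of_all _ fun ω => block_third_domination_op Y hκ₀ hκ₁ ha hκ₂ hκ₃ hτ hδ hstab hU'b hU''b hU₃b ψ₀ ψ hψ ω
  · -- continuity in `ψ` at fixed `ω`: `Φ(ω,ψ) = F(ω+ψ)` and `χ ↦ F(χ + 0)` is continuous by (418)
    have hsh : Continuous fun ψ : EuclideanSpace ℝ ι => ω + ψ := continuous_const.add continuous_id
    have h0 := (continuous_weightedBlockHess_deriv hUd hU'd hU''d hU₃c (0 : EuclideanSpace ℝ ι)).comp hsh
    refine (h0.congr fun ψ => ?_).continuousAt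
    simp only [Function.comp_apply, add_zero]

/-! ## §2. The third derivative is continuous -/

/-- The first term `ψ ↦ Z⁻¹•∫Φ + (Z⁻²G)⊗H` of `T` is continuous. [folklore] -/
theorem continuous_hessW_deriv_term1 (hM : M.PosDef) (hΓop : (γop • (1 : Matrix ι ι ℝ) - M⁻¹).PosSemidef) (Y : Finset ι)
    (hUd : ∀ φ : EuclideanSpace ℝ ι, HasFDerivAt U (U' φ) φ) (hU'd : ∀ φ : EuclideanSpace ℝ ι, HasFDerivAt U' (U'' φ) φ)
    (hU''d : ∀ φ : EuclideanSpace ℝ ι, HasFDerivAt U'' (U₃ φ) φ) (hU₃c : Continuous U₃) (hκ₀ : 0 ≤ κ₀) (hκ₁ : 0 ≤ κ₁) (ha : 0 ≤ a) (hκ₂ : 0 ≤ κ₂) (hκ₃ : 0 ≤ κ₃) (hτ : 0 <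
        τ) (hδ : 0 < δ)
    (hθ0 : 0 < θ) (hθ1 : θ < 1) (hκθ : (2 * κ₀ * (1 + τ) + 4 * δ) * γop ≤ θ) (hstab : ∀ φ : EuclideanSpace ℝ ι, -(κ₀ * ∑ x ∈ Y, φ x ^ 2) ≤ U φ)
    (hU'b : ∀ φ : EuclideanSpace ℝ ι, ‖U' φ‖ ≤ κ₁ * (a + ∑ x ∈ Y, φ x ^ 2)) (hU''b : ∀ φ : EuclideanSpace ℝ ι, ‖U'' φ‖ ≤ κ₂)
    (hU₃b : ∀ φ : EuclideanSpace ℝ ι, ‖U₃ φ‖ ≤ κ₃) :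
    Continuous fun ψ : EuclideanSpace ℝ ι => ((∫ ω : EuclideanSpace ℝ ι, exp (-U (ω + ψ)) ∂(multivariateGaussian 0 M⁻¹))⁻¹ • (∫ ω : EuclideanSpace ℝ ι, (exp (-U (ω + ψ)) •
        (U₃ (ω + ψ) - (((ContinuousLinearMap.smulRightL ℝ (EuclideanSpace ℝ ι) (EuclideanSpace ℝ ι →L[ℝ] ℝ)) (U' (ω + ψ))).comp (U'' (ω + ψ)) +
        (((ContinuousLinearMap.smulRightL ℝ (EuclideanSpace ℝ ι) (EuclideanSpace ℝ ι →L[ℝ] ℝ))).comp (U'' (ω + ψ))).flip (U' (ω + ψ)))) + (exp (-U (ω + ψ)) • -U' (ω +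
        ψ)).smulRight (U'' (ω + ψ) - (U' (ω + ψ)).smulRight (U' (ω + ψ)))) ∂(multivariateGaussian 0 M⁻¹)) + ((-((∫ ω : EuclideanSpace ℝ ι, exp (-U (ω + ψ))
        ∂(multivariateGaussian 0 M⁻¹)) ^ 2)⁻¹) • -(∫ ω : EuclideanSpace ℝ ι, exp (-U (ω + ψ)) • U' (ω + ψ) ∂(multivariateGaussian 0 M⁻¹))).smulRight (∫ ω : EuclideanSpace ℝ
        ι, exp (-U (ω + ψ)) • (U'' (ω + ψ) - (U' (ω + ψ)).smulRight (U' (ω + ψ))) ∂(multivariateGaussian 0 M⁻¹))) := by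
  obtain ⟨hZc, hZpos⟩ := continuous_blockZ hM hΓop Y hUd hU'd hκ₀ hκ₁ ha hτ hδ hθ0 hθ1 hκθ hstab hU'b
  have hGc := continuous_blockG hM hΓop Y hUd hU'd hU''d hκ₀ hκ₁ ha hκ₂ hτ hδ hθ1 hκθ hstab hU'b hU''b
  have hHc := continuous_blockH hM hΓop Y hUd hU'd hU''d hU₃c hκ₀ hκ₁ ha hκ₂ hκ₃ hτ hδ hθ1 hκθ hstab hU'b hU''b hU₃b
  have hTc := continuous_blockT3 hM hΓop Y hUd hU'd hU''d hU₃c hκ₀ hκ₁ ha hκ₂ hκ₃ hτ hδ hθ1 hκθ hstab hU'b hU''b hU₃b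
  have hZne : ∀ ψ : EuclideanSpace ℝ ι, (∫ ω : EuclideanSpace ℝ ι, exp (-U (ω + ψ)) ∂(multivariateGaussian 0 M⁻¹)) ≠ 0 := fun ψ => (hZpos ψ).ne'
  have hZi : Continuous fun ψ : EuclideanSpace ℝ ι => (∫ ω : EuclideanSpace ℝ ι, exp (-U (ω + ψ)) ∂(multivariateGaussian 0 M⁻¹))⁻¹ := hZc.inv₀ hZne
  have hZ2i : Continuous fun ψ : EuclideanSpace ℝ ι => ((∫ ω : EuclideanSpace ℝ ι, exp (-U (ω + ψ)) ∂(multivariateGaussian 0 M⁻¹)) ^ 2)⁻¹ := (hZc.pow 2).inv₀ fun ψ =>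
      pow_ne_zero 2 (hZne ψ)
  have h1b : Continuous fun ψ : EuclideanSpace ℝ ι => ((-((∫ ω : EuclideanSpace ℝ ι, exp (-U (ω + ψ)) ∂(multivariateGaussian 0 M⁻¹)) ^ 2)⁻¹) • -(∫ ω : EuclideanSpace ℝ ι,
      exp (-U (ω + ψ)) • U' (ω + ψ) ∂(multivariateGaussian 0 M⁻¹))).smulRight (∫ ω : EuclideanSpace ℝ ι, exp (-U (ω + ψ)) • (U'' (ω + ψ) - (U' (ω + ψ)).smulRight (U' (ω +
      ψ))) ∂(multivariateGaussian 0 M⁻¹)) :=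
    (isBoundedBilinearMap_smulRight (𝕜 := ℝ) (E := EuclideanSpace ℝ ι) (F := (EuclideanSpace ℝ ι →L[ℝ] EuclideanSpace ℝ ι →L[ℝ] ℝ))).continuous.comp ((hZ2i.neg.smul
        hGc.neg).prodMk hHc)
  exact (hZi.smul hTc).add h1b

/-- The derivative `ψ ↦ Z⁻²•H + (2Z⁻³G)⊗G` of `ψ ↦ Z⁻²•G` is continuous. [folklore] -/
theorem continuous_hessW_deriv_uprime (hM : M.PosDef) (hΓop : (γop • (1 : Matrix ι ι ℝ) - M⁻¹).PosSemidef) (Y : Finset ι)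
    (hUd : ∀ φ : EuclideanSpace ℝ ι, HasFDerivAt U (U' φ) φ) (hU'd : ∀ φ : EuclideanSpace ℝ ι, HasFDerivAt U' (U'' φ) φ)
    (hU''d : ∀ φ : EuclideanSpace ℝ ι, HasFDerivAt U'' (U₃ φ) φ) (hU₃c : Continuous U₃) (hκ₀ : 0 ≤ κ₀) (hκ₁ : 0 ≤ κ₁) (ha : 0 ≤ a) (hκ₂ : 0 ≤ κ₂) (hκ₃ : 0 ≤ κ₃) (hτ : 0 <
        τ) (hδ : 0 < δ)
    (hθ0 : 0 < θ) (hθ1 : θ < 1) (hκθ : (2 * κ₀ * (1 + τ) + 4 * δ) * γop ≤ θ) (hstab : ∀ φ : EuclideanSpace ℝ ι, -(κ₀ * ∑ x ∈ Y, φ x ^ 2) ≤ U φ)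
    (hU'b : ∀ φ : EuclideanSpace ℝ ι, ‖U' φ‖ ≤ κ₁ * (a + ∑ x ∈ Y, φ x ^ 2)) (hU''b : ∀ φ : EuclideanSpace ℝ ι, ‖U'' φ‖ ≤ κ₂)
    (hU₃b : ∀ φ : EuclideanSpace ℝ ι, ‖U₃ φ‖ ≤ κ₃) :
    Continuous fun ψ : EuclideanSpace ℝ ι => ((∫ ω : EuclideanSpace ℝ ι, exp (-U (ω + ψ)) ∂(multivariateGaussian 0 M⁻¹)) ^ 2)⁻¹ • (∫ ω : EuclideanSpace ℝ ι, exp (-U (ω +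
        ψ)) • (U'' (ω + ψ) - (U' (ω + ψ)).smulRight (U' (ω + ψ))) ∂(multivariateGaussian 0 M⁻¹)) + ((-2 / (∫ ω : EuclideanSpace ℝ ι, exp (-U (ω + ψ)) ∂(multivariateGaussian
        0 M⁻¹)) ^ 3) • -(∫ ω : EuclideanSpace ℝ ι, exp (-U (ω + ψ)) • U' (ω + ψ) ∂(multivariateGaussian 0 M⁻¹))).smulRight (∫ ω : EuclideanSpace ℝ ι, exp (-U (ω + ψ)) • U'
        (ω + ψ) ∂(multivariateGaussian 0 M⁻¹)) := by
  obtain ⟨hZc, hZpos⟩ := continuous_blockZ hM hΓop Y hUd hU'd hκ₀ hκ₁ ha hτ hδ hθ0 hθ1 hκθ hstab hU'b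
  have hGc := continuous_blockG hM hΓop Y hUd hU'd hU''d hκ₀ hκ₁ ha hκ₂ hτ hδ hθ1 hκθ hstab hU'b hU''b
  have hHc := continuous_blockH hM hΓop Y hUd hU'd hU''d hU₃c hκ₀ hκ₁ ha hκ₂ hκ₃ hτ hδ hθ1 hκθ hstab hU'b hU''b hU₃b
  have hZne : ∀ ψ : EuclideanSpace ℝ ι, (∫ ω : EuclideanSpace ℝ ι, exp (-U (ω + ψ)) ∂(multivariateGaussian 0 M⁻¹)) ≠ 0 := fun ψ => (hZpos ψ).ne'
  have hZ2i : Continuous fun ψ : EuclideanSpace ℝ ι => ((∫ ω : EuclideanSpace ℝ ι, exp (-U (ω + ψ)) ∂(multivariateGaussian 0 M⁻¹)) ^ 2)⁻¹ := (hZc.pow 2).inv₀ fun ψ =>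
      pow_ne_zero 2 (hZne ψ)
  have hZ3 : Continuous fun ψ : EuclideanSpace ℝ ι => -2 / (∫ ω : EuclideanSpace ℝ ι, exp (-U (ω + ψ)) ∂(multivariateGaussian 0 M⁻¹)) ^ 3 := continuous_const.div (hZc.pow
      3) fun ψ => pow_ne_zero 3 (hZne ψ)
  exact (hZ2i.smul hHc).add ((isBoundedBilinearMap_smulRight (𝕜 := ℝ) (E := EuclideanSpace ℝ ι) (F := (EuclideanSpace ℝ ι →L[ℝ] ℝ))).continuous.comp ((hZ3.smul
      hGc.neg).prodMk hGc))

/-- The piece `ψ ↦ ((Z⁻²G)⊗·)∘H` of `T` is continuous. [folklore] -/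
theorem continuous_hessW_deriv_t2a (hM : M.PosDef) (hΓop : (γop • (1 : Matrix ι ι ℝ) - M⁻¹).PosSemidef) (Y : Finset ι)
    (hUd : ∀ φ : EuclideanSpace ℝ ι, HasFDerivAt U (U' φ) φ) (hU'd : ∀ φ : EuclideanSpace ℝ ι, HasFDerivAt U' (U'' φ) φ)
    (hU''d : ∀ φ : EuclideanSpace ℝ ι, HasFDerivAt U'' (U₃ φ) φ) (hU₃c : Continuous U₃) (hκ₀ : 0 ≤ κ₀) (hκ₁ : 0 ≤ κ₁) (ha : 0 ≤ a) (hκ₂ : 0 ≤ κ₂) (hκ₃ : 0 ≤ κ₃) (hτ : 0 <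
        τ) (hδ : 0 < δ)
    (hθ0 : 0 < θ) (hθ1 : θ < 1) (hκθ : (2 * κ₀ * (1 + τ) + 4 * δ) * γop ≤ θ) (hstab : ∀ φ : EuclideanSpace ℝ ι, -(κ₀ * ∑ x ∈ Y, φ x ^ 2) ≤ U φ)
    (hU'b : ∀ φ : EuclideanSpace ℝ ι, ‖U' φ‖ ≤ κ₁ * (a + ∑ x ∈ Y, φ x ^ 2)) (hU''b : ∀ φ : EuclideanSpace ℝ ι, ‖U'' φ‖ ≤ κ₂)
    (hU₃b : ∀ φ : EuclideanSpace ℝ ι, ‖U₃ φ‖ ≤ κ₃) :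
    Continuous fun ψ : EuclideanSpace ℝ ι => ((ContinuousLinearMap.smulRightL ℝ (EuclideanSpace ℝ ι) (EuclideanSpace ℝ ι →L[ℝ] ℝ)) (((∫ ω : EuclideanSpace ℝ ι, exp (-U (ω +
        ψ)) ∂(multivariateGaussian 0 M⁻¹)) ^ 2)⁻¹ • (∫ ω : EuclideanSpace ℝ ι, exp (-U (ω + ψ)) • U' (ω + ψ) ∂(multivariateGaussian 0 M⁻¹)))).comp (∫ ω : EuclideanSpace ℝ
        ι, exp (-U (ω + ψ)) • (U'' (ω + ψ) - (U' (ω + ψ)).smulRight (U' (ω + ψ))) ∂(multivariateGaussian 0 M⁻¹)) := by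
  obtain ⟨hZc, hZpos⟩ := continuous_blockZ hM hΓop Y hUd hU'd hκ₀ hκ₁ ha hτ hδ hθ0 hθ1 hκθ hstab hU'b
  have hGc := continuous_blockG hM hΓop Y hUd hU'd hU''d hκ₀ hκ₁ ha hκ₂ hτ hδ hθ1 hκθ hstab hU'b hU''b
  have hHc := continuous_blockH hM hΓop Y hUd hU'd hU''d hU₃c hκ₀ hκ₁ ha hκ₂ hκ₃ hτ hδ hθ1 hκθ hstab hU'b hU''b hU₃b
  have hZ2i : Continuous fun ψ : EuclideanSpace ℝ ι => ((∫ ω : EuclideanSpace ℝ ι, exp (-U (ω + ψ)) ∂(multivariateGaussian 0 M⁻¹)) ^ 2)⁻¹ := (hZc.pow 2).inv₀ fun ψ =>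
      pow_ne_zero 2 (hZpos ψ).ne'
  exact (isBoundedBilinearMap_comp (𝕜 := ℝ) (E := EuclideanSpace ℝ ι) (F := (EuclideanSpace ℝ ι →L[ℝ] ℝ)) (G := (EuclideanSpace ℝ ι →L[ℝ] EuclideanSpace ℝ ι →L[ℝ]
      ℝ))).continuous.comp ((((ContinuousLinearMap.smulRightL ℝ (EuclideanSpace ℝ ι) (EuclideanSpace ℝ ι →L[ℝ] ℝ))).continuous.comp (hZ2i.smul hGc)).prodMk hHc)

/-- The piece `ψ ↦ (⊗)∘u′` is continuous. [folklore] -/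
theorem continuous_hessW_deriv_t2b0 (hM : M.PosDef) (hΓop : (γop • (1 : Matrix ι ι ℝ) - M⁻¹).PosSemidef) (Y : Finset ι)
    (hUd : ∀ φ : EuclideanSpace ℝ ι, HasFDerivAt U (U' φ) φ) (hU'd : ∀ φ : EuclideanSpace ℝ ι, HasFDerivAt U' (U'' φ) φ)
    (hU''d : ∀ φ : EuclideanSpace ℝ ι, HasFDerivAt U'' (U₃ φ) φ) (hU₃c : Continuous U₃) (hκ₀ : 0 ≤ κ₀) (hκ₁ : 0 ≤ κ₁) (ha : 0 ≤ a) (hκ₂ : 0 ≤ κ₂) (hκ₃ : 0 ≤ κ₃) (hτ : 0 <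
        τ) (hδ : 0 < δ)
    (hθ0 : 0 < θ) (hθ1 : θ < 1) (hκθ : (2 * κ₀ * (1 + τ) + 4 * δ) * γop ≤ θ) (hstab : ∀ φ : EuclideanSpace ℝ ι, -(κ₀ * ∑ x ∈ Y, φ x ^ 2) ≤ U φ)
    (hU'b : ∀ φ : EuclideanSpace ℝ ι, ‖U' φ‖ ≤ κ₁ * (a + ∑ x ∈ Y, φ x ^ 2)) (hU''b : ∀ φ : EuclideanSpace ℝ ι, ‖U'' φ‖ ≤ κ₂)
    (hU₃b : ∀ φ : EuclideanSpace ℝ ι, ‖U₃ φ‖ ≤ κ₃) :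
    Continuous fun ψ : EuclideanSpace ℝ ι => ((ContinuousLinearMap.smulRightL ℝ (EuclideanSpace ℝ ι) (EuclideanSpace ℝ ι →L[ℝ] ℝ))).comp (((∫ ω : EuclideanSpace ℝ ι, exp
        (-U (ω + ψ)) ∂(multivariateGaussian 0 M⁻¹)) ^ 2)⁻¹ • (∫ ω : EuclideanSpace ℝ ι, exp (-U (ω + ψ)) • (U'' (ω + ψ) - (U' (ω + ψ)).smulRight (U' (ω + ψ)))
        ∂(multivariateGaussian 0 M⁻¹)) + ((-2 / (∫ ω : EuclideanSpace ℝ ι, exp (-U (ω + ψ)) ∂(multivariateGaussian 0 M⁻¹)) ^ 3) • -(∫ ω : EuclideanSpace ℝ ι, exp (-U (ω +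
        ψ)) • U' (ω + ψ) ∂(multivariateGaussian 0 M⁻¹))).smulRight (∫ ω : EuclideanSpace ℝ ι, exp (-U (ω + ψ)) • U' (ω + ψ) ∂(multivariateGaussian 0 M⁻¹))) :=
  (isBoundedBilinearMap_comp (𝕜 := ℝ) (E := EuclideanSpace ℝ ι) (F := (EuclideanSpace ℝ ι →L[ℝ] ℝ)) (G := (EuclideanSpace ℝ ι →L[ℝ] ℝ) →L[ℝ] (EuclideanSpace ℝ ι →L[ℝ]
      EuclideanSpace ℝ ι →L[ℝ] ℝ))).continuous.comp
    (continuous_const.prodMk (continuous_hessW_deriv_uprime hM hΓop Y hUd hU'd hU''d hU₃c hκ₀ hκ₁ ha hκ₂ hκ₃ hτ hδ hθ0 hθ1 hκθ hstab hU'b hU''b hU₃b))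

/-- The piece `ψ ↦ ((⊗)∘u′)ᵀG` of `T` is continuous. [folklore] -/
theorem continuous_hessW_deriv_t2b (hM : M.PosDef) (hΓop : (γop • (1 : Matrix ι ι ℝ) - M⁻¹).PosSemidef) (Y : Finset ι)
    (hUd : ∀ φ : EuclideanSpace ℝ ι, HasFDerivAt U (U' φ) φ) (hU'd : ∀ φ : EuclideanSpace ℝ ι, HasFDerivAt U' (U'' φ) φ)
    (hU''d : ∀ φ : EuclideanSpace ℝ ι, HasFDerivAt U'' (U₃ φ) φ) (hU₃c : Continuous U₃) (hκ₀ : 0 ≤ κ₀) (hκ₁ : 0 ≤ κ₁) (ha : 0 ≤ a) (hκ₂ : 0 ≤ κ₂) (hκ₃ : 0 ≤ κ₃) (hτ : 0 <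
        τ) (hδ : 0 < δ)
    (hθ0 : 0 < θ) (hθ1 : θ < 1) (hκθ : (2 * κ₀ * (1 + τ) + 4 * δ) * γop ≤ θ) (hstab : ∀ φ : EuclideanSpace ℝ ι, -(κ₀ * ∑ x ∈ Y, φ x ^ 2) ≤ U φ)
    (hU'b : ∀ φ : EuclideanSpace ℝ ι, ‖U' φ‖ ≤ κ₁ * (a + ∑ x ∈ Y, φ x ^ 2)) (hU''b : ∀ φ : EuclideanSpace ℝ ι, ‖U'' φ‖ ≤ κ₂)
    (hU₃b : ∀ φ : EuclideanSpace ℝ ι, ‖U₃ φ‖ ≤ κ₃) :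
    Continuous fun ψ : EuclideanSpace ℝ ι => ((((ContinuousLinearMap.smulRightL ℝ (EuclideanSpace ℝ ι) (EuclideanSpace ℝ ι →L[ℝ] ℝ))).comp (((∫ ω : EuclideanSpace ℝ ι, exp
        (-U (ω + ψ)) ∂(multivariateGaussian 0 M⁻¹)) ^ 2)⁻¹ • (∫ ω : EuclideanSpace ℝ ι, exp (-U (ω + ψ)) • (U'' (ω + ψ) - (U' (ω + ψ)).smulRight (U' (ω + ψ)))
        ∂(multivariateGaussian 0 M⁻¹)) + ((-2 / (∫ ω : EuclideanSpace ℝ ι, exp (-U (ω + ψ)) ∂(multivariateGaussian 0 M⁻¹)) ^ 3) • -(∫ ω : EuclideanSpace ℝ ι, exp (-U (ω +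
        ψ)) • U' (ω + ψ) ∂(multivariateGaussian 0 M⁻¹))).smulRight (∫ ω : EuclideanSpace ℝ ι, exp (-U (ω + ψ)) • U' (ω + ψ) ∂(multivariateGaussian 0 M⁻¹))))).flip (∫ ω :
        EuclideanSpace ℝ ι, exp (-U (ω + ψ)) • U' (ω + ψ) ∂(multivariateGaussian 0 M⁻¹)) :=
  (isBoundedBilinearMap_apply (𝕜 := ℝ) (E := (EuclideanSpace ℝ ι →L[ℝ] ℝ)) (F := (EuclideanSpace ℝ ι →L[ℝ] EuclideanSpace ℝ ι →L[ℝ] EuclideanSpace ℝ ι →L[ℝ]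
      ℝ))).continuous.comp
    ((((ContinuousLinearMap.flipₗᵢ ℝ (EuclideanSpace ℝ ι) (EuclideanSpace ℝ ι →L[ℝ] ℝ) (EuclideanSpace ℝ ι →L[ℝ] EuclideanSpace ℝ ι →L[ℝ] ℝ)).continuous.comp
        (continuous_hessW_deriv_t2b0 hM hΓop Y hUd hU'd hU''d hU₃c hκ₀ hκ₁ ha hκ₂ hκ₃ hτ hδ hθ0 hθ1 hκθ hstab hU'b hU''b hU₃b))).prodMk (continuous_blockG hM hΓop Y hUd
        hU'd hU''d hκ₀ hκ₁ ha hκ₂ hτ hδ hθ1 hκθ hstab hU'b hU''b))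

/-- The second term `ψ ↦ ((Z⁻²G)⊗·)∘H + ((⊗)∘u′)ᵀG` of `T` is continuous. [folklore] -/
theorem continuous_hessW_deriv_term2 (hM : M.PosDef) (hΓop : (γop • (1 : Matrix ι ι ℝ) - M⁻¹).PosSemidef) (Y : Finset ι)
    (hUd : ∀ φ : EuclideanSpace ℝ ι, HasFDerivAt U (U' φ) φ) (hU'd : ∀ φ : EuclideanSpace ℝ ι, HasFDerivAt U' (U'' φ) φ)
    (hU''d : ∀ φ : EuclideanSpace ℝ ι, HasFDerivAt U'' (U₃ φ) φ) (hU₃c : Continuous U₃) (hκ₀ : 0 ≤ κ₀) (hκ₁ : 0 ≤ κ₁) (ha : 0 ≤ a) (hκ₂ : 0 ≤ κ₂) (hκ₃ : 0 ≤ κ₃) (hτ : 0 <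
        τ) (hδ : 0 < δ)
    (hθ0 : 0 < θ) (hθ1 : θ < 1) (hκθ : (2 * κ₀ * (1 + τ) + 4 * δ) * γop ≤ θ) (hstab : ∀ φ : EuclideanSpace ℝ ι, -(κ₀ * ∑ x ∈ Y, φ x ^ 2) ≤ U φ)
    (hU'b : ∀ φ : EuclideanSpace ℝ ι, ‖U' φ‖ ≤ κ₁ * (a + ∑ x ∈ Y, φ x ^ 2)) (hU''b : ∀ φ : EuclideanSpace ℝ ι, ‖U'' φ‖ ≤ κ₂)
    (hU₃b : ∀ φ : EuclideanSpace ℝ ι, ‖U₃ φ‖ ≤ κ₃) :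
    Continuous fun ψ : EuclideanSpace ℝ ι => (((ContinuousLinearMap.smulRightL ℝ (EuclideanSpace ℝ ι) (EuclideanSpace ℝ ι →L[ℝ] ℝ)) (((∫ ω : EuclideanSpace ℝ ι, exp (-U (ω
        + ψ)) ∂(multivariateGaussian 0 M⁻¹)) ^ 2)⁻¹ • (∫ ω : EuclideanSpace ℝ ι, exp (-U (ω + ψ)) • U' (ω + ψ) ∂(multivariateGaussian 0 M⁻¹)))).comp (∫ ω : EuclideanSpace ℝ
        ι, exp (-U (ω + ψ)) • (U'' (ω + ψ) - (U' (ω + ψ)).smulRight (U' (ω + ψ))) ∂(multivariateGaussian 0 M⁻¹)) +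
      (((ContinuousLinearMap.smulRightL ℝ (EuclideanSpace ℝ ι) (EuclideanSpace ℝ ι →L[ℝ] ℝ))).comp (((∫ ω : EuclideanSpace ℝ ι, exp (-U (ω + ψ)) ∂(multivariateGaussian 0
          M⁻¹)) ^ 2)⁻¹ • (∫ ω : EuclideanSpace ℝ ι, exp (-U (ω + ψ)) • (U'' (ω + ψ) - (U' (ω + ψ)).smulRight (U' (ω + ψ))) ∂(multivariateGaussian 0 M⁻¹)) + ((-2 / (∫ ω :
          EuclideanSpace ℝ ι, exp (-U (ω + ψ)) ∂(multivariateGaussian 0 M⁻¹)) ^ 3) • -(∫ ω : EuclideanSpace ℝ ι, exp (-U (ω + ψ)) • U' (ω + ψ) ∂(multivariateGaussian 0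
          M⁻¹))).smulRight (∫ ω : EuclideanSpace ℝ ι, exp (-U (ω + ψ)) • U' (ω + ψ) ∂(multivariateGaussian 0 M⁻¹)))).flip (∫ ω : EuclideanSpace ℝ ι, exp (-U (ω + ψ)) • U'
          (ω + ψ) ∂(multivariateGaussian 0 M⁻¹))) :=
  (continuous_hessW_deriv_t2a hM hΓop Y hUd hU'd hU''d hU₃c hκ₀ hκ₁ ha hκ₂ hκ₃ hτ hδ hθ0 hθ1 hκθ hstab hU'b hU''b hU₃b).add (continuous_hessW_deriv_t2b hM hΓop Y hUd hU'd
      hU''d hU₃c hκ₀ hκ₁ ha hκ₂ hκ₃ hτ hδ hθ0 hθ1 hκθ hstab hU'b hU''b hU₃b)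

/-- **THE THIRD DERIVATIVE `ψ ↦ T(ψ)` OF `W` IS CONTINUOUS.** [folklore] -/
theorem continuous_hessW_deriv (hM : M.PosDef) (hΓop : (γop • (1 : Matrix ι ι ℝ) - M⁻¹).PosSemidef) (Y : Finset ι)
    (hUd : ∀ φ : EuclideanSpace ℝ ι, HasFDerivAt U (U' φ) φ) (hU'd : ∀ φ : EuclideanSpace ℝ ι, HasFDerivAt U' (U'' φ) φ)
    (hU''d : ∀ φ : EuclideanSpace ℝ ι, HasFDerivAt U'' (U₃ φ) φ) (hU₃c : Continuous U₃) (hκ₀ : 0 ≤ κ₀) (hκ₁ : 0 ≤ κ₁) (ha : 0 ≤ a) (hκ₂ : 0 ≤ κ₂) (hκ₃ : 0 ≤ κ₃) (hτ : 0 <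
        τ) (hδ : 0 < δ)
    (hθ0 : 0 < θ) (hθ1 : θ < 1) (hκθ : (2 * κ₀ * (1 + τ) + 4 * δ) * γop ≤ θ) (hstab : ∀ φ : EuclideanSpace ℝ ι, -(κ₀ * ∑ x ∈ Y, φ x ^ 2) ≤ U φ)
    (hU'b : ∀ φ : EuclideanSpace ℝ ι, ‖U' φ‖ ≤ κ₁ * (a + ∑ x ∈ Y, φ x ^ 2)) (hU''b : ∀ φ : EuclideanSpace ℝ ι, ‖U'' φ‖ ≤ κ₂)
    (hU₃b : ∀ φ : EuclideanSpace ℝ ι, ‖U₃ φ‖ ≤ κ₃) :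
    Continuous fun ψ : EuclideanSpace ℝ ι => (((∫ ω : EuclideanSpace ℝ ι, exp (-U (ω + ψ)) ∂(multivariateGaussian 0 M⁻¹))⁻¹ • (∫ ω : EuclideanSpace ℝ ι, (exp (-U (ω + ψ)) •
        (U₃ (ω + ψ) - (((ContinuousLinearMap.smulRightL ℝ (EuclideanSpace ℝ ι) (EuclideanSpace ℝ ι →L[ℝ] ℝ)) (U' (ω + ψ))).comp (U'' (ω + ψ)) +
        (((ContinuousLinearMap.smulRightL ℝ (EuclideanSpace ℝ ι) (EuclideanSpace ℝ ι →L[ℝ] ℝ))).comp (U'' (ω + ψ))).flip (U' (ω + ψ)))) + (exp (-U (ω + ψ)) • -U' (ω +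
        ψ)).smulRight (U'' (ω + ψ) - (U' (ω + ψ)).smulRight (U' (ω + ψ)))) ∂(multivariateGaussian 0 M⁻¹)) + ((-((∫ ω : EuclideanSpace ℝ ι, exp (-U (ω + ψ))
        ∂(multivariateGaussian 0 M⁻¹)) ^ 2)⁻¹) • -(∫ ω : EuclideanSpace ℝ ι, exp (-U (ω + ψ)) • U' (ω + ψ) ∂(multivariateGaussian 0 M⁻¹))).smulRight (∫ ω : EuclideanSpace ℝ
        ι, exp (-U (ω + ψ)) • (U'' (ω + ψ) - (U' (ω + ψ)).smulRight (U' (ω + ψ))) ∂(multivariateGaussian 0 M⁻¹))) + (((ContinuousLinearMap.smulRightL ℝ (EuclideanSpace ℝ ι)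
        (EuclideanSpace ℝ ι →L[ℝ] ℝ)) (((∫ ω : EuclideanSpace ℝ ι, exp (-U (ω + ψ)) ∂(multivariateGaussian 0 M⁻¹)) ^ 2)⁻¹ • (∫ ω : EuclideanSpace ℝ ι, exp (-U (ω + ψ)) • U'
        (ω + ψ) ∂(multivariateGaussian 0 M⁻¹)))).comp (∫ ω : EuclideanSpace ℝ ι, exp (-U (ω + ψ)) • (U'' (ω + ψ) - (U' (ω + ψ)).smulRight (U' (ω + ψ)))
        ∂(multivariateGaussian 0 M⁻¹)) + (((ContinuousLinearMap.smulRightL ℝ (EuclideanSpace ℝ ι) (EuclideanSpace ℝ ι →L[ℝ] ℝ))).comp (((∫ ω : EuclideanSpace ℝ ι, exp (-U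
        (ω + ψ)) ∂(multivariateGaussian 0 M⁻¹)) ^ 2)⁻¹ • (∫ ω : EuclideanSpace ℝ ι, exp (-U (ω + ψ)) • (U'' (ω + ψ) - (U' (ω + ψ)).smulRight (U' (ω + ψ)))
        ∂(multivariateGaussian 0 M⁻¹)) + ((-2 / (∫ ω : EuclideanSpace ℝ ι, exp (-U (ω + ψ)) ∂(multivariateGaussian 0 M⁻¹)) ^ 3) • -(∫ ω : EuclideanSpace ℝ ι, exp (-U (ω +
        ψ)) • U' (ω + ψ) ∂(multivariateGaussian 0 M⁻¹))).smulRight (∫ ω : EuclideanSpace ℝ ι, exp (-U (ω + ψ)) • U' (ω + ψ) ∂(multivariateGaussian 0 M⁻¹)))).flip (∫ ω :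
        EuclideanSpace ℝ ι, exp (-U (ω + ψ)) • U' (ω + ψ) ∂(multivariateGaussian 0 M⁻¹)))) :=
  (continuous_hessW_deriv_term1 hM hΓop Y hUd hU'd hU''d hU₃c hκ₀ hκ₁ ha hκ₂ hκ₃ hτ hδ hθ0 hθ1 hκθ hstab hU'b hU''b hU₃b).add (continuous_hessW_deriv_term2 hM hΓop Y hUd
      hU'd hU''d hU₃c hκ₀ hκ₁ ha hκ₂ hκ₃ hτ hδ hθ0 hθ1 hκθ hstab hU'b hU''b hU₃b)

/-! ## §3. THE END: the output's third derivative exists and is continuous -/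

/-- **THE OUTPUT'S SECOND DERIVATIVE IS DIFFERENTIABLE**: for (415)'s `(w⁺)″(ζ) = HessW(ψ₀+ζ) − ½(L+Lᵀ)`, at EVERY `ζ`,
`HasFDerivAt (w⁺)″ (T(ψ₀+ζ)) ζ` — the input format's `hU''d` for the output with `U₃⁺(ζ) = T(ψ₀+ζ)`. [folklore] -/
theorem hasFDerivAt_blockOutput_hess (hM : M.PosDef) (hΓop : (γop • (1 : Matrix ι ι ℝ) - M⁻¹).PosSemidef) (Y : Finset ι)
    (hUd : ∀ φ : EuclideanSpace ℝ ι, HasFDerivAt U (U' φ) φ) (hU'd : ∀ φ : EuclideanSpace ℝ ι, HasFDerivAt U' (U'' φ) φ)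
    (hU''d : ∀ φ : EuclideanSpace ℝ ι, HasFDerivAt U'' (U₃ φ) φ) (hU₃c : Continuous U₃) (hκ₀ : 0 ≤ κ₀) (hκ₁ : 0 ≤ κ₁) (ha : 0 ≤ a) (hκ₂ : 0 ≤ κ₂) (hκ₃ : 0 ≤ κ₃) (hτ : 0 <
        τ) (hδ : 0 < δ)
    (hθ0 : 0 < θ) (hθ1 : θ < 1) (hκθ : (2 * κ₀ * (1 + τ) + 4 * δ) * γop ≤ θ) (hstab : ∀ φ : EuclideanSpace ℝ ι, -(κ₀ * ∑ x ∈ Y, φ x ^ 2) ≤ U φ)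
    (hU'b : ∀ φ : EuclideanSpace ℝ ι, ‖U' φ‖ ≤ κ₁ * (a + ∑ x ∈ Y, φ x ^ 2)) (hU''b : ∀ φ : EuclideanSpace ℝ ι, ‖U'' φ‖ ≤ κ₂)
    (hU₃b : ∀ φ : EuclideanSpace ℝ ι, ‖U₃ φ‖ ≤ κ₃) (ψ₀ ζ : EuclideanSpace ℝ ι) :
    HasFDerivAt (fun ζ : EuclideanSpace ℝ ι => (((∫ ω : EuclideanSpace ℝ ι, exp (-U (ω + (ψ₀ + ζ))) ∂(multivariateGaussian 0 M⁻¹))⁻¹ • (∫ ω : EuclideanSpace ℝ ι, exp (-U (ω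
        + (ψ₀ + ζ))) • (U'' (ω + (ψ₀ + ζ)) - (U' (ω + (ψ₀ + ζ))).smulRight (U' (ω + (ψ₀ + ζ)))) ∂(multivariateGaussian 0 M⁻¹)) + (((∫ ω : EuclideanSpace ℝ ι, exp (-U (ω +
        (ψ₀ + ζ))) ∂(multivariateGaussian 0 M⁻¹)) ^ 2)⁻¹ • ∫ ω : EuclideanSpace ℝ ι, exp (-U (ω + (ψ₀ + ζ))) • U' (ω + (ψ₀ + ζ)) ∂(multivariateGaussian 0 M⁻¹)).smulRight (∫
        ω : EuclideanSpace ℝ ι, exp (-U (ω + (ψ₀ + ζ))) • U' (ω + (ψ₀ + ζ)) ∂(multivariateGaussian 0 M⁻¹))) - ((2 : ℝ)⁻¹ • (((∫ ω : EuclideanSpace ℝ ι, exp (-U (ω + ψ₀))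
        ∂(multivariateGaussian 0 M⁻¹))⁻¹ • (∫ ω : EuclideanSpace ℝ ι, exp (-U (ω + ψ₀)) • (U'' (ω + ψ₀) - (U' (ω + ψ₀)).smulRight (U' (ω + ψ₀))) ∂(multivariateGaussian 0
        M⁻¹)) + (((∫ ω : EuclideanSpace ℝ ι, exp (-U (ω + ψ₀)) ∂(multivariateGaussian 0 M⁻¹)) ^ 2)⁻¹ • ∫ ω : EuclideanSpace ℝ ι, exp (-U (ω + ψ₀)) • U' (ω + ψ₀)
        ∂(multivariateGaussian 0 M⁻¹)).smulRight (∫ ω : EuclideanSpace ℝ ι, exp (-U (ω + ψ₀)) • U' (ω + ψ₀) ∂(multivariateGaussian 0 M⁻¹))) + (((∫ ω : EuclideanSpace ℝ ι,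
        exp (-U (ω + ψ₀)) ∂(multivariateGaussian 0 M⁻¹))⁻¹ • (∫ ω : EuclideanSpace ℝ ι, exp (-U (ω + ψ₀)) • (U'' (ω + ψ₀) - (U' (ω + ψ₀)).smulRight (U' (ω + ψ₀)))
        ∂(multivariateGaussian 0 M⁻¹)) + (((∫ ω : EuclideanSpace ℝ ι, exp (-U (ω + ψ₀)) ∂(multivariateGaussian 0 M⁻¹)) ^ 2)⁻¹ • ∫ ω : EuclideanSpace ℝ ι, exp (-U (ω + ψ₀))
        • U' (ω + ψ₀) ∂(multivariateGaussian 0 M⁻¹)).smulRight (∫ ω : EuclideanSpace ℝ ι, exp (-U (ω + ψ₀)) • U' (ω + ψ₀) ∂(multivariateGaussian 0 M⁻¹)))).flip))))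
      (((∫ ω : EuclideanSpace ℝ ι, exp (-U (ω + (ψ₀ + ζ))) ∂(multivariateGaussian 0 M⁻¹))⁻¹ • (∫ ω : EuclideanSpace ℝ ι, (exp (-U (ω + (ψ₀ + ζ))) • (U₃ (ω + (ψ₀ + ζ)) -
          (((ContinuousLinearMap.smulRightL ℝ (EuclideanSpace ℝ ι) (EuclideanSpace ℝ ι →L[ℝ] ℝ)) (U' (ω + (ψ₀ + ζ)))).comp (U'' (ω + (ψ₀ + ζ))) +
          (((ContinuousLinearMap.smulRightL ℝ (EuclideanSpace ℝ ι) (EuclideanSpace ℝ ι →L[ℝ] ℝ))).comp (U'' (ω + (ψ₀ + ζ)))).flip (U' (ω + (ψ₀ + ζ))))) + (exp (-U (ω + (ψ₀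
          + ζ))) • -U' (ω + (ψ₀ + ζ))).smulRight (U'' (ω + (ψ₀ + ζ)) - (U' (ω + (ψ₀ + ζ))).smulRight (U' (ω + (ψ₀ + ζ))))) ∂(multivariateGaussian 0 M⁻¹)) + ((-((∫ ω :
          EuclideanSpace ℝ ι, exp (-U (ω + (ψ₀ + ζ))) ∂(multivariateGaussian 0 M⁻¹)) ^ 2)⁻¹) • -(∫ ω : EuclideanSpace ℝ ι, exp (-U (ω + (ψ₀ + ζ))) • U' (ω + (ψ₀ + ζ))
          ∂(multivariateGaussian 0 M⁻¹))).smulRight (∫ ω : EuclideanSpace ℝ ι, exp (-U (ω + (ψ₀ + ζ))) • (U'' (ω + (ψ₀ + ζ)) - (U' (ω + (ψ₀ + ζ))).smulRight (U' (ω + (ψ₀ +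
          ζ)))) ∂(multivariateGaussian 0 M⁻¹))) + (((ContinuousLinearMap.smulRightL ℝ (EuclideanSpace ℝ ι) (EuclideanSpace ℝ ι →L[ℝ] ℝ)) (((∫ ω : EuclideanSpace ℝ ι, exp
          (-U (ω + (ψ₀ + ζ))) ∂(multivariateGaussian 0 M⁻¹)) ^ 2)⁻¹ • (∫ ω : EuclideanSpace ℝ ι, exp (-U (ω + (ψ₀ + ζ))) • U' (ω + (ψ₀ + ζ)) ∂(multivariateGaussian 0
          M⁻¹)))).comp (∫ ω : EuclideanSpace ℝ ι, exp (-U (ω + (ψ₀ + ζ))) • (U'' (ω + (ψ₀ + ζ)) - (U' (ω + (ψ₀ + ζ))).smulRight (U' (ω + (ψ₀ + ζ)))) ∂(multivariateGaussian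
          0 M⁻¹)) + (((ContinuousLinearMap.smulRightL ℝ (EuclideanSpace ℝ ι) (EuclideanSpace ℝ ι →L[ℝ] ℝ))).comp (((∫ ω : EuclideanSpace ℝ ι, exp (-U (ω + (ψ₀ + ζ)))
          ∂(multivariateGaussian 0 M⁻¹)) ^ 2)⁻¹ • (∫ ω : EuclideanSpace ℝ ι, exp (-U (ω + (ψ₀ + ζ))) • (U'' (ω + (ψ₀ + ζ)) - (U' (ω + (ψ₀ + ζ))).smulRight (U' (ω + (ψ₀ +
          ζ)))) ∂(multivariateGaussian 0 M⁻¹)) + ((-2 / (∫ ω : EuclideanSpace ℝ ι, exp (-U (ω + (ψ₀ + ζ))) ∂(multivariateGaussian 0 M⁻¹)) ^ 3) • -(∫ ω : EuclideanSpace ℝ ι,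
          exp (-U (ω + (ψ₀ + ζ))) • U' (ω + (ψ₀ + ζ)) ∂(multivariateGaussian 0 M⁻¹))).smulRight (∫ ω : EuclideanSpace ℝ ι, exp (-U (ω + (ψ₀ + ζ))) • U' (ω + (ψ₀ + ζ))
          ∂(multivariateGaussian 0 M⁻¹)))).flip (∫ ω : EuclideanSpace ℝ ι, exp (-U (ω + (ψ₀ + ζ))) • U' (ω + (ψ₀ + ζ)) ∂(multivariateGaussian 0 M⁻¹)))) ζ := by
  have hΓ : (M⁻¹).PosSemidef := hM.inv.posSemidef
  have h := (hasFDerivAt_hessW hΓ hΓop Y hUd hU'd hU''d hU₃c hκ₀ hκ₁ ha hκ₂ hκ₃ hτ hδ hθ0 hθ1 hκθ hstab hU'b hU''b hU₃b (ψ₀ + ζ)).comp ζ ((hasFDerivAt_id ζ).const_add ψ₀)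
  rw [ContinuousLinearMap.comp_id] at h
  exact h.sub_const ((2 : ℝ)⁻¹ • (((∫ ω : EuclideanSpace ℝ ι, exp (-U (ω + ψ₀)) ∂(multivariateGaussian 0 M⁻¹))⁻¹ • (∫ ω : EuclideanSpace ℝ ι, exp (-U (ω + ψ₀)) • (U'' (ω +
      ψ₀) - (U' (ω + ψ₀)).smulRight (U' (ω + ψ₀))) ∂(multivariateGaussian 0 M⁻¹)) + (((∫ ω : EuclideanSpace ℝ ι, exp (-U (ω + ψ₀)) ∂(multivariateGaussian 0 M⁻¹)) ^ 2)⁻¹ • ∫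
      ω : EuclideanSpace ℝ ι, exp (-U (ω + ψ₀)) • U' (ω + ψ₀) ∂(multivariateGaussian 0 M⁻¹)).smulRight (∫ ω : EuclideanSpace ℝ ι, exp (-U (ω + ψ₀)) • U' (ω + ψ₀)
      ∂(multivariateGaussian 0 M⁻¹))) + (((∫ ω : EuclideanSpace ℝ ι, exp (-U (ω + ψ₀)) ∂(multivariateGaussian 0 M⁻¹))⁻¹ • (∫ ω : EuclideanSpace ℝ ι, exp (-U (ω + ψ₀)) •
      (U'' (ω + ψ₀) - (U' (ω + ψ₀)).smulRight (U' (ω + ψ₀))) ∂(multivariateGaussian 0 M⁻¹)) + (((∫ ω : EuclideanSpace ℝ ι, exp (-U (ω + ψ₀)) ∂(multivariateGaussian 0 M⁻¹))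
      ^ 2)⁻¹ • ∫ ω : EuclideanSpace ℝ ι, exp (-U (ω + ψ₀)) • U' (ω + ψ₀) ∂(multivariateGaussian 0 M⁻¹)).smulRight (∫ ω : EuclideanSpace ℝ ι, exp (-U (ω + ψ₀)) • U' (ω + ψ₀)
      ∂(multivariateGaussian 0 M⁻¹)))).flip))

/-- **THE OUTPUT'S THIRD DERIVATIVE IS CONTINUOUS**: `ζ ↦ T(ψ₀+ζ)` is continuous — the input format's `hU₃c` for the output. [folklore] -/
theorem continuous_blockOutput_third (hM : M.PosDef) (hΓop : (γop • (1 : Matrix ι ι ℝ) - M⁻¹).PosSemidef) (Y : Finset ι)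
    (hUd : ∀ φ : EuclideanSpace ℝ ι, HasFDerivAt U (U' φ) φ) (hU'd : ∀ φ : EuclideanSpace ℝ ι, HasFDerivAt U' (U'' φ) φ)
    (hU''d : ∀ φ : EuclideanSpace ℝ ι, HasFDerivAt U'' (U₃ φ) φ) (hU₃c : Continuous U₃) (hκ₀ : 0 ≤ κ₀) (hκ₁ : 0 ≤ κ₁) (ha : 0 ≤ a) (hκ₂ : 0 ≤ κ₂) (hκ₃ : 0 ≤ κ₃) (hτ : 0 <
        τ) (hδ : 0 < δ)
    (hθ0 : 0 < θ) (hθ1 : θ < 1) (hκθ : (2 * κ₀ * (1 + τ) + 4 * δ) * γop ≤ θ) (hstab : ∀ φ : EuclideanSpace ℝ ι, -(κ₀ * ∑ x ∈ Y, φ x ^ 2) ≤ U φ)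
    (hU'b : ∀ φ : EuclideanSpace ℝ ι, ‖U' φ‖ ≤ κ₁ * (a + ∑ x ∈ Y, φ x ^ 2)) (hU''b : ∀ φ : EuclideanSpace ℝ ι, ‖U'' φ‖ ≤ κ₂)
    (hU₃b : ∀ φ : EuclideanSpace ℝ ι, ‖U₃ φ‖ ≤ κ₃) (ψ₀ : EuclideanSpace ℝ ι) :
    Continuous fun ζ : EuclideanSpace ℝ ι => (((∫ ω : EuclideanSpace ℝ ι, exp (-U (ω + (ψ₀ + ζ))) ∂(multivariateGaussian 0 M⁻¹))⁻¹ • (∫ ω : EuclideanSpace ℝ ι, (exp (-U (ω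
        + (ψ₀ + ζ))) • (U₃ (ω + (ψ₀ + ζ)) - (((ContinuousLinearMap.smulRightL ℝ (EuclideanSpace ℝ ι) (EuclideanSpace ℝ ι →L[ℝ] ℝ)) (U' (ω + (ψ₀ + ζ)))).comp (U'' (ω + (ψ₀ +
        ζ))) + (((ContinuousLinearMap.smulRightL ℝ (EuclideanSpace ℝ ι) (EuclideanSpace ℝ ι →L[ℝ] ℝ))).comp (U'' (ω + (ψ₀ + ζ)))).flip (U' (ω + (ψ₀ + ζ))))) + (exp (-U (ω +
        (ψ₀ + ζ))) • -U' (ω + (ψ₀ + ζ))).smulRight (U'' (ω + (ψ₀ + ζ)) - (U' (ω + (ψ₀ + ζ))).smulRight (U' (ω + (ψ₀ + ζ))))) ∂(multivariateGaussian 0 M⁻¹)) + ((-((∫ ω :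
        EuclideanSpace ℝ ι, exp (-U (ω + (ψ₀ + ζ))) ∂(multivariateGaussian 0 M⁻¹)) ^ 2)⁻¹) • -(∫ ω : EuclideanSpace ℝ ι, exp (-U (ω + (ψ₀ + ζ))) • U' (ω + (ψ₀ + ζ))
        ∂(multivariateGaussian 0 M⁻¹))).smulRight (∫ ω : EuclideanSpace ℝ ι, exp (-U (ω + (ψ₀ + ζ))) • (U'' (ω + (ψ₀ + ζ)) - (U' (ω + (ψ₀ + ζ))).smulRight (U' (ω + (ψ₀ +
        ζ)))) ∂(multivariateGaussian 0 M⁻¹))) + (((ContinuousLinearMap.smulRightL ℝ (EuclideanSpace ℝ ι) (EuclideanSpace ℝ ι →L[ℝ] ℝ)) (((∫ ω : EuclideanSpace ℝ ι, exp (-U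
        (ω + (ψ₀ + ζ))) ∂(multivariateGaussian 0 M⁻¹)) ^ 2)⁻¹ • (∫ ω : EuclideanSpace ℝ ι, exp (-U (ω + (ψ₀ + ζ))) • U' (ω + (ψ₀ + ζ)) ∂(multivariateGaussian 0 M⁻¹)))).comp
        (∫ ω : EuclideanSpace ℝ ι, exp (-U (ω + (ψ₀ + ζ))) • (U'' (ω + (ψ₀ + ζ)) - (U' (ω + (ψ₀ + ζ))).smulRight (U' (ω + (ψ₀ + ζ)))) ∂(multivariateGaussian 0 M⁻¹)) +
        (((ContinuousLinearMap.smulRightL ℝ (EuclideanSpace ℝ ι) (EuclideanSpace ℝ ι →L[ℝ] ℝ))).comp (((∫ ω : EuclideanSpace ℝ ι, exp (-U (ω + (ψ₀ + ζ)))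
        ∂(multivariateGaussian 0 M⁻¹)) ^ 2)⁻¹ • (∫ ω : EuclideanSpace ℝ ι, exp (-U (ω + (ψ₀ + ζ))) • (U'' (ω + (ψ₀ + ζ)) - (U' (ω + (ψ₀ + ζ))).smulRight (U' (ω + (ψ₀ +
        ζ)))) ∂(multivariateGaussian 0 M⁻¹)) + ((-2 / (∫ ω : EuclideanSpace ℝ ι, exp (-U (ω + (ψ₀ + ζ))) ∂(multivariateGaussian 0 M⁻¹)) ^ 3) • -(∫ ω : EuclideanSpace ℝ ι,
        exp (-U (ω + (ψ₀ + ζ))) • U' (ω + (ψ₀ + ζ)) ∂(multivariateGaussian 0 M⁻¹))).smulRight (∫ ω : EuclideanSpace ℝ ι, exp (-U (ω + (ψ₀ + ζ))) • U' (ω + (ψ₀ + ζ))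
        ∂(multivariateGaussian 0 M⁻¹)))).flip (∫ ω : EuclideanSpace ℝ ι, exp (-U (ω + (ψ₀ + ζ))) • U' (ω + (ψ₀ + ζ)) ∂(multivariateGaussian 0 M⁻¹)))) :=
  (continuous_hessW_deriv hM hΓop Y hUd hU'd hU''d hU₃c hκ₀ hκ₁ ha hκ₂ hκ₃ hτ hδ hθ0 hθ1 hκθ hstab hU'b hU''b hU₃b).comp (continuous_const.add continuous_id)

end Main

/-! ## §4. Toy -/

/-- Toy: a constant trilinear map is a continuous function of the background. -/
example (T : EuclideanSpace ℝ ι →L[ℝ] EuclideanSpace ℝ ι →L[ℝ] EuclideanSpace ℝ ι →L[ℝ] ℝ) :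
    Continuous fun _ : EuclideanSpace ℝ ι => T := continuous_const

end Summit.QuantumFields.BalabanUV.T4Continuum.NE7b.SupBlockThirdDerivativeContinuous
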